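import Literature.ModelTheory.Zilber.EACDensityFamilies
import Literature.NumberTheory.Transcendental.LindemannWeierstrassProofs
import HarnessLib

/-!
# Mantova–Masser's unprojected-density question: the resonant counterexample and the
oscillatory constant-fibre regime

Literature module (Zilber's Exponential-Algebraic-Closedness programme, the `EC(3,2)` ladder node
"density of unprojected exponential points").  HONEST FRAMING: everything here concerns the
auxiliary question raised by Mantova–Masser [MantovaMasser2023, §1 Further remarks, p. 5]
("It is also natural to consider the distribution of the unprojected points … In our situation the
analogous statement is unclear, even for `n = 2`. This is illustrated by case (dim-pi-S-1-free) in
Theorem 1.2"), typed in `EACDensityQuestion` as `MMCaseDimPiOneFree W → UnprojectedDense W`.  It is a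
modest rung far below Zilber's conjecture, which is NOT Schanuel's conjecture and does not imply it.

## What this file proves (all unconditional, no `sorry`)

* **NEG — the typed question, as literally transcribed, has answer NO**
  (`not_forall_mmCaseDimPiOneFree_unprojectedDense`).  The *resonant parabola*
  `S_res = {x₁ = x₀² / (2πi), y₀ = 1}` (`resonantParabola`) satisfies every hypothesis of case
  (dim-pi-S-1-free) (`mmCase_resonantParabola`: irreducible surface meeting the torus, `dim cl π(S) = 1`,
  `cl π(S)` a parabola, not a line of rational slope), its exponential points are exactly
  `(2πik, 2πik², 1, 1)`, `k ∈ ℤ` (`mem_resonantParabola_inter_expGraph_iff`) — infinitely many, with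
  Zariski-dense projection as Thm. 1.2 predicts — but they all lie on the curve `{y₁ = 1} ∩ S_res`, so
  they are NOT Zariski dense in `S_res` (`not_unprojectedDense_resonantParabola`).  The mechanism is
  the general finite-range criterion `not_unprojectedDense_const_of_finite`: on a constant-fibre surface
  `{x₁ = p(x₀), y₀ = e^{z₀}}` the exponential points have `x₀ ∈ z₀ + 2πiℤ`, and if `e^{p}` takes finitely
  many values there, a product of `y₁ - c` kills them.  The obstruction is MULTIPLICATIVE DEPENDENCE
  (`y₀` constant: `not_isMulFree_graphPolySurface_C`); Thm. 1.2's case list only involves the additive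
  side.  Consequently the bridges `ecCellAperiodic_one_of_unprojectedDense`,
  `ecCell_two_one_of_unprojectedDense` of `EACDensityQuestion` have a false hypothesis; the repaired,
  still OPEN question adds multiplicative freeness (the inline hypothesis
  `∀ W, MMCaseDimPiOneFree W → IsMulFree ℂ 2 (W ∩ G²) → UnprojectedDense W` of the repaired bridge
  `ecCellAperiodic_one_of_mmDensityFree` — never asserted, and not given a name of its own: open
  questions are not Literature facts; by [AslanyanGallinaro2024, Remark 3.5] it would follow from
  Zilber's conjecture for free rotund `S`), recorded together with the
  descent of multiplicative freeness along coordinate projections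
  (`IsMulFree.of_image_subset`, `isMulFree_projClosure_inter_torusLocus`) needed one dimension up.
* **POS — oscillatory constant fibres** (`unprojectedDense_const_of_irrational`): for
  `S = {x₁ = p(x₀), y₀ = e^{z₀}}` with `deg p ≥ 1`, if `Re p` is constant on `z₀ + 2πiℕ` (the fibre values
  `w_k = e^{p(z₀ + 2πik)}` stay on a circle — the regime left open by the growth/decay files
  `EACDensityGrowth`, `EACDensityFamilies`) and the top phase `θ`,
  `θ · 2πi = (deg p)! · lc(p) · (2πi)^{deg p}`, is IRRATIONAL, then the exponential points are Zariski
  dense.  Proof ("differencing + pigeonhole", no equidistribution): if `G(w, z) ∈ ℂ[w][z]` vanishes at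
  `(w_k, z_k)` with `|z_k| → ∞` and `w_k` on a circle, its leading `z`-coefficient `h(w)` satisfies
  `h(w_k) → 0`, so the cluster points of `w_k` are roots of `h` (`clusterIn_roots_of_tendsto`); cluster
  sets in a finite set are stable under the multiplicative difference `w_{k+1}/w_k`
  (`clusterIn_mulShift`); but the `(deg p - 1)`-st multiplicative difference of `w_k` is the rotation
  `c₀ ζ^k`, `ζ = e^{2πiθ}` not a root of unity (forward differences of polynomials,
  `Polynomial.fwdDiff_iter_degree_eq_factorial`), whose values cannot cluster in a finite set
  (`not_clusterIn_rotation`, pigeonhole).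
  The abstract elimination lemma is `eq_zero_of_eval₂_eq_zero_of_rotation`; the density criterion it
  yields for the graph-polynomial family is `unprojectedDense_graphPolySurface_of_rotation` (transposed
  pull-back `gpPullbackT` to `ℂ[w][z]`).
* **The cubic with constant fibre** `S_cub = {x₁ = x₀³, y₀ = 1}` (`cubicConstOne`): here `θ = -24π²`,
  irrational by Lindemann (`transcendental_pi_holds`, proved in the tree), so its exponential points
  `(2πik, (2πik)³, 1, e^{-8π³ik³})` are Zariski dense (`unprojectedDense_cubicConstOne`,
  `unprojectedDensityQuestion_instance_cubicConstOne`) — although this surface is exactly as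
  multiplicatively degenerate as the resonant parabola (`not_isMulFree_cubicConstOne`); and had `π²`
  been rational they would not be (`not_unprojectedDense_cubicConstOne_of_rat`).  So inside the
  non-free constant-fibre family the answer to Mantova–Masser's question is governed by arithmetic
  (`θ ∈ ℚ` versus `θ ∉ ℚ`), not by geometry.

Sources: [MantovaMasser2023] V. Mantova, D. Masser, *Polynomial-exponential equations — some new
cases of solvability*, arXiv:2303.05592, Thm. 1.2 (p. 4) and §1 Further remarks (p. 5);
[AslanyanGallinaro2024] V. Aslanyan, F. Gallinaro, arXiv:2409.12860, Def. 3.3, Conj. 3.4, Remark 3.5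
(pp. 12–13); Lindemann 1882 via the tree theorem
`Literature.NumberTheory.Transcendental.transcendental_pi_holds`.  The elimination/differencing
argument is elementary and presumably folklore (van der Corput differencing in its crudest form); no
claim of priority.  Nothing here is, or is used as, evidence for Schanuel's conjecture.
-/

noncomputable section

open Filter Topology MvPolynomial Complex fwdDiff

namespace Literature.ModelTheory.Zilber

open Literature.NumberTheory.Transcendental Literature.ModelTheory.ExponentialFields

/-! ## Part A. Constant fibres: the exponential points and the finite-range obstruction -/

section ConstFibre

variable {p : Polynomial ℂ} {c : ℂ}

/-- `F ∈ I(V)` evaluates to zero on `V` (Mathlib's `vanishingIdeal`, `eval` form). [folklore] -/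
theorem eval_eq_zero_of_mem_vanishingIdeal {σ : Type*} {F : MvPolynomial σ ℂ} {V : Set (σ → ℂ)}
    (hF : F ∈ vanishingIdeal ℂ V) {x : σ → ℂ} (hx : x ∈ V) : MvPolynomial.eval x F = 0 := by
  rw [← coe_aeval_eq_eval]
  exact (mem_vanishingIdeal_iff.mp hF) x hx

/-- `eval`-form of membership in `I(V)`. [folklore] -/
theorem mem_vanishingIdeal_of_eval {σ : Type*} {F : MvPolynomial σ ℂ} {V : Set (σ → ℂ)}
    (h : ∀ x ∈ V, MvPolynomial.eval x F = 0) : F ∈ vanishingIdeal ℂ V := by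
  rw [mem_vanishingIdeal_iff]
  intro x hx
  have h1 := h x hx
  rwa [← coe_aeval_eq_eval] at h1

/-- **The exponential points of a constant-fibre surface** `{x₁ = p(x₀), y₀ = c}`: `e^{x₀} = c` and
`y₁ = e^{p(x₀)}`. [folklore] -/
theorem exp_eq_of_mem_const_inter_expGraph {s : Fin 2 ⊕ Fin 2 → ℂ}
    (hs : s ∈ graphPolySurface p (Polynomial.C c) ∩ expGraph ℂ 2) :
    exp (s (Sum.inl 0)) = c ∧ s (Sum.inr 1) = exp (p.eval (s (Sum.inl 0))) := by
  obtain ⟨hsS, hsE⟩ := hs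
  rw [mem_graphPolySurface_iff] at hsS
  rw [mem_expGraph_iff] at hsE
  refine ⟨?_, ?_⟩
  · have h0 := hsE 0
    rw [hsS.2, Polynomial.eval_C] at h0
    simpa [ExponentialRing.complex_exp_eq] using h0.symm
  · have h1 := hsE 1
    rw [hsS.1] at h1
    simpa [ExponentialRing.complex_exp_eq] using h1

/-- Hence, if `c = e^{z₀}`, every exponential point of `{x₁ = p(x₀), y₀ = c}` is
`(z₀ + 2πik, p(z₀ + 2πik), c, e^{p(z₀ + 2πik)})` for some `k ∈ ℤ`. [folklore] -/
theorem exists_int_of_mem_const_inter_expGraph {z₀ : ℂ} (hc : exp z₀ = c) {s : Fin 2 ⊕ Fin 2 → ℂ}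
    (hs : s ∈ graphPolySurface p (Polynomial.C c) ∩ expGraph ℂ 2) :
    ∃ k : ℤ, s (Sum.inl 0) = z₀ + k * (2 * Real.pi * I) ∧
      s = gpParam p (Polynomial.C c) (z₀ + k * (2 * Real.pi * I))
        (exp (p.eval (z₀ + k * (2 * Real.pi * I)))) := by
  obtain ⟨hu, hw⟩ := exp_eq_of_mem_const_inter_expGraph hs
  rw [← hc] at hu
  obtain ⟨k, hk⟩ := Complex.exp_eq_exp_iff_exists_int.mp hu
  refine ⟨k, hk, ?_⟩
  have h := eq_gpParam_of_mem p (Polynomial.C c) hs.1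
  rw [hw, hk] at h
  exact h

/-- Conversely these points are exponential points. [folklore] -/
theorem gpParam_const_mem_inter_expGraph {z₀ : ℂ} (hc : exp z₀ = c) (k : ℤ) :
    gpParam p (Polynomial.C c) (z₀ + k * (2 * Real.pi * I))
        (exp (p.eval (z₀ + k * (2 * Real.pi * I)))) ∈
      graphPolySurface p (Polynomial.C c) ∩ expGraph ℂ 2 := by
  refine ⟨gpParam_mem _ _ _ _, gpParam_mem_expGraph _ _ ?_ rfl⟩
  rw [Polynomial.eval_C, Complex.exp_add, hc, Complex.exp_int_mul_two_pi_mul_I, mul_one]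

/-- **Finite-range obstruction.** If `c = e^{z₀}` and the fibre values `e^{p(z₀ + 2πik)}`, `k ∈ ℤ`, all
lie in a finite set `F`, then the exponential points of `{x₁ = p(x₀), y₀ = c}` are NOT Zariski dense:
`∏_{a ∈ F} (y₁ - a)` vanishes on them but not on the surface. [folklore] -/
theorem not_unprojectedDense_const_of_finite (p : Polynomial ℂ) {c z₀ : ℂ} (hc : exp z₀ = c)
    (F : Finset ℂ) (hF : ∀ k : ℤ, exp (p.eval (z₀ + k * (2 * Real.pi * I))) ∈ F) :
    ¬ UnprojectedDense (graphPolySurface p (Polynomial.C c)) := by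
  classical
  intro hD
  set G : MvPolynomial (Fin 2 ⊕ Fin 2) ℂ := ∏ a ∈ F, (X (Sum.inr 1) - MvPolynomial.C a) with hG
  have hGI : G ∈ vanishingIdeal ℂ (graphPolySurface p (Polynomial.C c) ∩ expGraph ℂ 2) := by
    refine mem_vanishingIdeal_of_eval fun s hs => ?_
    obtain ⟨k, -, hsk⟩ := exists_int_of_mem_const_inter_expGraph hc hs
    rw [hG, map_prod]
    refine Finset.prod_eq_zero (hF k) ?_
    rw [hsk]
    simp
  rw [hD] at hGI
  obtain ⟨a', ha'⟩ := Infinite.exists_notMem_finset F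
  have h := eval_eq_zero_of_mem_vanishingIdeal hGI (gpParam_mem p (Polynomial.C c) 0 a')
  rw [hG, map_prod, Finset.prod_eq_zero_iff] at h
  obtain ⟨a, haF, ha0⟩ := h
  simp only [map_sub, MvPolynomial.eval_X, gpParam_inr_one, MvPolynomial.eval_C, sub_eq_zero] at ha0
  exact ha' (ha0 ▸ haF)

/-- A constant-fibre surface `{x₁ = p(x₀), y₀ = c}` is never multiplicatively free (`y₀ = c` on it);
this is the degeneracy behind the counterexample below. [folklore] -/
theorem not_isMulFree_graphPolySurface_C (p : Polynomial ℂ) (c : ℂ) :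
    ¬ IsMulFree ℂ 2 (graphPolySurface p (Polynomial.C c) ∩ torusLocus ℂ 2) := by
  intro h
  refine h (Pi.single 0 1) ?_ ⟨c, fun z hz => ?_⟩
  · intro h0
    have := congrFun h0 0
    simp at this
  · have hz0 : z (Sum.inr 0) = c := by
      have := (mem_graphPolySurface_iff _ _ z).mp hz.1
      rw [this.2, Polynomial.eval_C]
    rw [Fin.prod_univ_two]
    simp [hz0]

end ConstFibre

/-! ## Part B. The resonant parabola `{x₁ = x₀²/(2πi), y₀ = 1}`: case (dim-pi-S-1-free) holds,
density fails -/

section Resonant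

/-- The polynomial `x² / (2πi)`. [folklore] -/
def resonantPoly : Polynomial ℂ := Polynomial.C (2 * Real.pi * I)⁻¹ * Polynomial.X ^ 2

/-- **The resonant parabola** `S_res = {x₁ = x₀² / (2πi), y₀ = 1} ⊆ ℂ² × ℂ²`. (new in this file)
[folklore] -/
def resonantParabola : Set (Fin 2 ⊕ Fin 2 → ℂ) := graphPolySurface resonantPoly (Polynomial.C 1)

/-- `deg (x²/(2πi)) = 2`. [folklore] -/
theorem natDegree_resonantPoly : resonantPoly.natDegree = 2 := by
  rw [resonantPoly, Polynomial.natDegree_C_mul_X_pow]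
  exact inv_ne_zero Complex.two_pi_I_ne_zero

/-- On `2πiℤ` the resonant polynomial takes values in `2πiℤ`: `(2πik)²/(2πi) = 2πi k²`. [folklore] -/
theorem resonantPoly_eval_int (k : ℤ) :
    resonantPoly.eval ((k : ℂ) * (2 * Real.pi * I)) = ((k ^ 2 : ℤ) : ℂ) * (2 * Real.pi * I) := by
  simp only [resonantPoly, Polynomial.eval_mul, Polynomial.eval_C, Polynomial.eval_pow,
    Polynomial.eval_X]
  push_cast
  field_simp

/-- Hence `e^{p(2πik)} = 1` for every `k ∈ ℤ`: ALL fibre values of exponential points equal `1`.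
[folklore] -/
theorem exp_resonantPoly_eval_int (k : ℤ) :
    exp (resonantPoly.eval ((0 : ℂ) + (k : ℂ) * (2 * Real.pi * I))) = 1 := by
  rw [zero_add, resonantPoly_eval_int, Complex.exp_int_mul_two_pi_mul_I]

/-- **The exponential points of the resonant parabola are exactly `(2πik, 2πik², 1, 1)`, `k ∈ ℤ`.**
[folklore] -/
theorem mem_resonantParabola_inter_expGraph_iff (s : Fin 2 ⊕ Fin 2 → ℂ) :
    s ∈ resonantParabola ∩ expGraph ℂ 2 ↔
      ∃ k : ℤ, s = gpParam resonantPoly (Polynomial.C 1) ((k : ℂ) * (2 * Real.pi * I)) 1 := by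
  constructor
  · intro hs
    obtain ⟨k, -, hsk⟩ := exists_int_of_mem_const_inter_expGraph (p := resonantPoly)
      Complex.exp_zero hs
    refine ⟨k, ?_⟩
    rw [hsk, exp_resonantPoly_eval_int, zero_add]
  · rintro ⟨k, rfl⟩
    have h := gpParam_const_mem_inter_expGraph (p := resonantPoly) Complex.exp_zero k
    rwa [exp_resonantPoly_eval_int, zero_add] at h

/-- **`S_res` is in Mantova–Masser's case (dim-pi-S-1-free)**: irreducible surface meeting the torus,
`dim cl π(S) = 1`, and `cl π(S) = {x₁ = x₀²/(2πi)}` is not a line of rational slope.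
[cite: MantovaMasser2023, Thm. 1.2 case (dim-pi-S-1-free), p. 4] -/
theorem mmCase_resonantParabola : MMCaseDimPiOneFree resonantParabola :=
  mmCase_graphPolySurface_of_two_le (natDegree_resonantPoly ▸ le_rfl)
    (Polynomial.C_ne_zero.mpr one_ne_zero)

/-- **… but its exponential points are NOT Zariski dense in it**: they lie on `{y₁ = 1}`.
(new in this file) [folklore] -/
theorem not_unprojectedDense_resonantParabola : ¬ UnprojectedDense resonantParabola :=
  not_unprojectedDense_const_of_finite resonantPoly Complex.exp_zero {1} fun k => by
    rw [exp_resonantPoly_eval_int]; exact Finset.mem_singleton_self 1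

/-- `S_res` is not multiplicatively free (`y₀ = 1`). [folklore] -/
theorem not_isMulFree_resonantParabola : ¬ IsMulFree ℂ 2 (resonantParabola ∩ torusLocus ℂ 2) :=
  not_isMulFree_graphPolySurface_C _ _

/-- **Mantova–Masser's unprojected-density question, as transcribed in `EACDensityQuestion`
(hypotheses of case (dim-pi-S-1-free) only), has a NEGATIVE answer.**  Witness: the resonant parabola.
This decides the typed question `∀ W, MMCaseDimPiOneFree W → UnprojectedDense W` (it is FALSE); the
hypothesis of `ecCellAperiodic_one_of_unprojectedDense` / `ecCell_two_one_of_unprojectedDense` is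
therefore vacuous, and the mathematically live question is the free version (the hypothesis of
`ecCellAperiodic_one_of_mmDensityFree` below). (new in this file) [cite: MantovaMasser2023, §1 Further remarks, p. 5] -/
theorem not_forall_mmCaseDimPiOneFree_unprojectedDense :
    ¬ ∀ W : Set (Fin 2 ⊕ Fin 2 → ℂ), MMCaseDimPiOneFree W → UnprojectedDense W := fun h =>
  not_unprojectedDense_resonantParabola (h _ mmCase_resonantParabola)

/-- Existential form: a surface of case (dim-pi-S-1-free) whose exponential points are not Zariski
dense. [folklore] -/
theorem exists_mmCase_not_unprojectedDense :
    ∃ W : Set (Fin 2 ⊕ Fin 2 → ℂ), MMCaseDimPiOneFree W ∧ ¬ UnprojectedDense W :=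
  ⟨resonantParabola, mmCase_resonantParabola, not_unprojectedDense_resonantParabola⟩

end Resonant

/-! ## Part C. The repaired (free) question and the repaired bridge -/

section Free

/-- **Repaired bridge.**  Mantova–Masser's density question in FREE form — for every surface
`W ⊆ ℂ² × ℂ²` of case (dim-pi-S-1-free) whose torus part is moreover multiplicatively free, the
exponential points are Zariski dense in `W` — is taken here only as the inline HYPOTHESIS `h` (it is
not settled and is deliberately not a named `Prop` of this library; by [AslanyanGallinaro2024,
Remark 3.5], not formalised here, it would follow from Zilber's Exponential-Algebraic-Closedness
conjecture, such `W ∩ G²` being free and rotund).  A YES gives the aperiodic sub-cell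
`ECCellAperiodic 1` (whose binders include multiplicative freeness), exactly as in
`ecCellAperiodic_one_of_unprojectedDense`. [cite: MantovaMasser2023, §1 Further remarks, p. 5] -/
theorem ecCellAperiodic_one_of_mmDensityFree
    (h : ∀ W : Set (Fin 2 ⊕ Fin 2 → ℂ), MMCaseDimPiOneFree W →
      IsMulFree ℂ 2 (W ∩ torusLocus ℂ 2) → UnprojectedDense W) :
    ECCellAperiodic 1 := by
  intro W hW hne _hadd hmul hdim hbase hper
  have hnl : ¬ IsRationalSlopeLine
      (zeroLocus ℂ (vanishingIdeal ℂ (projAdd '' (W ∩ torusLocus ℂ 2)))) := fun hL =>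
    hper ((hasIntegerPeriod_projAdd_iff_isRationalSlopeLine hW hne hbase).2 hL)
  exact inter_expGraph_nonempty_of_vanishingIdeal_eq (hne.mono Set.inter_subset_left)
    (h W ⟨hW, hne, hdim, hbase, hnl⟩ hmul)

/-- Hence also `EC(2, 1)` (`ecCell_two_one_iff_ecCellAperiodic_one`). [folklore] -/
theorem ecCell_two_one_of_mmDensityFree
    (h : ∀ W : Set (Fin 2 ⊕ Fin 2 → ℂ), MMCaseDimPiOneFree W →
      IsMulFree ℂ 2 (W ∩ torusLocus ℂ 2) → UnprojectedDense W) : ECCell 2 1 :=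
  ecCell_two_one_iff_ecCellAperiodic_one.2 (ecCellAperiodic_one_of_mmDensityFree h)

/-- **Multiplicative freeness descends along the coordinate projection** forgetting the last
`x`- and `y`-coordinates: if `V ⊆ ℂ^{d+1} × ℂ^{d+1}` is multiplicatively free then so is every set
containing its projection (a monomial relation downstairs pulls back with exponent `0` in the last
variable). [folklore] -/
theorem IsMulFree.of_image_subset {K : Type*} [Field K] {d : ℕ}
    {V : Set (Fin (d + 1) ⊕ Fin (d + 1) → K)} (hV : IsMulFree K (d + 1) V)
    {S : Set (Fin d ⊕ Fin d → K)}
    (hS : (fun (w : Fin (d + 1) ⊕ Fin (d + 1) → K) (t : Fin d ⊕ Fin d) =>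
      w (Sum.map Fin.castSucc Fin.castSucc t)) '' V ⊆ S) :
    IsMulFree K d S := by
  rintro m hm ⟨c, hc⟩
  refine hV (Fin.snoc m 0) ?_ ⟨c, fun z hz => ?_⟩
  · intro h0
    apply hm
    funext i
    have := congrFun h0 (Fin.castSucc i)
    rwa [Fin.snoc_castSucc] at this
  · have h := hc _ (hS ⟨z, hz, rfl⟩)
    simp only [Sum.map_inr] at h
    rw [Fin.prod_univ_castSucc]
    simp only [Fin.snoc_castSucc, Fin.snoc_last, zpow_zero, mul_one]
    exact h

/-- In particular, for `W ⊆ ℂ^{d+1} × ℂ^{d+1}` with multiplicatively free torus part, the torus part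
of the Zariski closure `cl pr(W ∩ G^{d+1}) ⊆ ℂ^d × ℂ^d` of its projection is multiplicatively free —
the extra hypothesis the repaired bridge `ecCellAperiodic_one_of_mmDensityFree` asks for, available
from the binders of the `EC(3,2)` pieces. [folklore] -/
theorem isMulFree_projClosure_inter_torusLocus {K : Type*} [Field K] {d : ℕ}
    {W : Set (Fin (d + 1) ⊕ Fin (d + 1) → K)}
    (hW : IsMulFree K (d + 1) (W ∩ torusLocus K (d + 1))) :
    IsMulFree K d (zeroLocus K (vanishingIdeal K
      ((fun (w : Fin (d + 1) ⊕ Fin (d + 1) → K) (t : Fin d ⊕ Fin d) =>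
        w (Sum.map Fin.castSucc Fin.castSucc t)) '' (W ∩ torusLocus K (d + 1)))) ∩
      torusLocus K d) := by
  refine IsMulFree.of_image_subset hW ?_
  rintro _ ⟨w, hw, rfl⟩
  exact ⟨le_zeroLocus_iff_le_vanishingIdeal.2 le_rfl ⟨w, hw, rfl⟩,
    fun i => by simpa only [Sum.map_inr] using hw.2 (Fin.castSucc i)⟩

end Free

/-! ## Part D. Cluster sets of bounded sequences, multiplicative differences, rotations -/

section Cluster

/-- `ClusterIn u Z`: every subsequential limit of the sequence `u : ℕ → ℂ` lies in the finite set
`Z`. (new in this file) [folklore] -/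
def ClusterIn (u : ℕ → ℂ) (Z : Finset ℂ) : Prop :=
  ∀ φ : ℕ → ℕ, StrictMono φ → ∀ a : ℂ, Tendsto (u ∘ φ) atTop (𝓝 a) → a ∈ Z

/-- The multiplicative difference `u_{k+1} / u_k` of a sequence. (new in this file) [folklore] -/
def mulShift (u : ℕ → ℂ) (k : ℕ) : ℂ := u (k + 1) / u k

variable {u v : ℕ → ℂ} {Z Z' : Finset ℂ} {A B : ℝ}

/-- **Roots capture cluster points**: if `h ≠ 0` and `h(u_k) → 0` then every subsequential limit of
`u` is a root of `h`. [folklore] -/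
theorem clusterIn_roots_of_tendsto {h : Polynomial ℂ} (h0 : h ≠ 0)
    (hu : Tendsto (fun k => ‖h.eval (u k)‖) atTop (𝓝 0)) : ClusterIn u h.roots.toFinset := by
  intro φ hφ a ha
  have h1 : Tendsto (fun n => ‖h.eval (u (φ n))‖) atTop (𝓝 ‖h.eval a‖) :=
    ((h.continuous.tendsto a).comp ha).norm
  have h2 : Tendsto (fun n => ‖h.eval (u (φ n))‖) atTop (𝓝 0) := hu.comp hφ.tendsto_atTop
  have h3 : ‖h.eval a‖ = 0 := tendsto_nhds_unique h1 h2
  rw [norm_eq_zero] at h3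
  exact Multiset.mem_toFinset.mpr ((Polynomial.mem_roots h0).mpr h3)

/-- A bounded sequence clustering in `Z` is eventually within any `ε` of `Z` (Bolzano–Weierstrass).
[folklore] -/
theorem ClusterIn.eventually_exists_norm_sub_lt (hu : ClusterIn u Z) (hB : ∀ k, ‖u k‖ ≤ B)
    {ε : ℝ} (hε : 0 < ε) : ∀ᶠ k in atTop, ∃ r ∈ Z, ‖u k - r‖ < ε := by
  by_contra hne
  rw [Filter.not_eventually] at hne
  obtain ⟨φ, hφ, hφP⟩ := extraction_of_frequently_atTop hne
  obtain ⟨a, -, ψ, hψ, ha⟩ := tendsto_subseq_of_bounded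
    (Metric.isBounded_closedBall (x := (0 : ℂ)) (r := B)) (x := u ∘ φ)
    (fun n => by simpa using hB (φ n))
  have haZ : a ∈ Z := hu (φ ∘ ψ) (hφ.comp hψ) a ha
  have hev : ∀ᶠ n in atTop, ‖(u ∘ φ) (ψ n) - a‖ < ε :=
    (tendsto_iff_norm_sub_tendsto_zero.mp ha).eventually_lt_const hε
  obtain ⟨n, hn⟩ := hev.exists
  exact hφP (ψ n) ⟨a, haZ, hn⟩

/-- Cluster sets are unchanged by the index shift `k ↦ k + 1`. [folklore] -/
theorem ClusterIn.comp_add_one (hu : ClusterIn u Z) : ClusterIn (fun k => u (k + 1)) Z :=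
  fun φ hφ a ha => hu (fun n => φ n + 1) (fun _ _ hmn => Nat.add_lt_add_right (hφ hmn) 1) a ha

/-- **Quotients**: if `u` clusters in `Z`, `v` in `Z'`, both bounded and `u` bounded away from `0`,
then `v / u` clusters in `{s / r : r ∈ Z, s ∈ Z'}` (two nested subsequence extractions).
[folklore] -/
theorem ClusterIn.div (hu : ClusterIn u Z) (hv : ClusterIn v Z') (hA : 0 < A)
    (hAu : ∀ k, A ≤ ‖u k‖) (hBu : ∀ k, ‖u k‖ ≤ B) (hBv : ∀ k, ‖v k‖ ≤ B) :
    ClusterIn (fun k => v k / u k) ((Z ×ˢ Z').image fun x => x.2 / x.1) := by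
  classical
  intro φ hφ a ha
  obtain ⟨r, -, ψ, hψ, hr⟩ := tendsto_subseq_of_bounded
    (Metric.isBounded_closedBall (x := (0 : ℂ)) (r := B)) (x := u ∘ φ)
    (fun n => by simpa using hBu (φ n))
  obtain ⟨s, -, χ, hχ, hs⟩ := tendsto_subseq_of_bounded
    (Metric.isBounded_closedBall (x := (0 : ℂ)) (r := B)) (x := v ∘ φ ∘ ψ)
    (fun n => by simpa using hBv (φ (ψ n)))
  have hrZ : r ∈ Z := hu (φ ∘ ψ) (hφ.comp hψ) r hr
  have hsZ : s ∈ Z' := hv (φ ∘ ψ ∘ χ) (hφ.comp (hψ.comp hχ)) s hs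
  have hr' : Tendsto (u ∘ φ ∘ ψ ∘ χ) atTop (𝓝 r) := hr.comp hχ.tendsto_atTop
  have hrA : A ≤ ‖r‖ := ge_of_tendsto' hr'.norm fun n => hAu _
  have hr0 : r ≠ 0 := fun h => by
    rw [h, norm_zero] at hrA
    exact absurd hrA (not_le.mpr hA)
  have hq : Tendsto (fun n => (v ∘ φ ∘ ψ ∘ χ) n / (u ∘ φ ∘ ψ ∘ χ) n) atTop (𝓝 (s / r)) :=
    hs.div hr' hr0
  have ha' : Tendsto ((fun k => v k / u k) ∘ φ ∘ ψ ∘ χ) atTop (𝓝 a) :=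
    ha.comp (hψ.comp hχ).tendsto_atTop
  have : a = s / r := tendsto_nhds_unique ha' hq
  rw [this]
  exact Finset.mem_image.mpr ⟨(r, s), Finset.mem_product.mpr ⟨hrZ, hsZ⟩, rfl⟩

/-- Bounds `A ≤ |u_k| ≤ B` give `A/B ≤ |u_{k+1}/u_k| ≤ B/A`. [folklore] -/
theorem norm_mulShift_bounds (hA : 0 < A) (hb : ∀ k, A ≤ ‖u k‖ ∧ ‖u k‖ ≤ B) (k : ℕ) :
    A / B ≤ ‖mulShift u k‖ ∧ ‖mulShift u k‖ ≤ B / A := by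
  have hB : 0 < B := hA.trans_le ((hb 0).1.trans (hb 0).2)
  have hk0 : 0 < ‖u k‖ := hA.trans_le (hb k).1
  rw [mulShift, norm_div]
  constructor
  · rw [div_le_div_iff₀ hB hk0]
    nlinarith [(hb k).2, (hb (k + 1)).1, hA.le, hB.le]
  · rw [div_le_div_iff₀ hk0 hA]
    nlinarith [(hb (k + 1)).2, (hb k).1, hA.le, norm_nonneg (u (k + 1))]

/-- **Multiplicative differences preserve finite clustering**: `u_{k+1}/u_k` clusters in
`{s / r : r, s ∈ Z}`. [folklore] -/
theorem clusterIn_mulShift (hu : ClusterIn u Z) (hA : 0 < A) (hb : ∀ k, A ≤ ‖u k‖ ∧ ‖u k‖ ≤ B) :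
    ClusterIn (mulShift u) ((Z ×ˢ Z).image fun x => x.2 / x.1) :=
  hu.div hu.comp_add_one hA (fun k => (hb k).1) (fun k => (hb k).2) fun k => (hb (k + 1)).2

/-- Iterating: the `j`-th multiplicative difference of a sequence in an annulus clustering in a
finite set again lies in an annulus and clusters in a finite set. [folklore] -/
theorem ClusterIn.iterate_mulShift (hu : ClusterIn u Z) (hA : 0 < A)
    (hb : ∀ k, A ≤ ‖u k‖ ∧ ‖u k‖ ≤ B) (j : ℕ) :
    ∃ (Z' : Finset ℂ) (A' B' : ℝ), 0 < A' ∧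
      (∀ k, A' ≤ ‖mulShift^[j] u k‖ ∧ ‖mulShift^[j] u k‖ ≤ B') ∧ ClusterIn (mulShift^[j] u) Z' := by
  induction j with
  | zero => exact ⟨Z, A, B, hA, hb, hu⟩
  | succ j ih =>
    obtain ⟨Z', A', B', hA', hb', hu'⟩ := ih
    refine ⟨(Z' ×ˢ Z').image fun x => x.2 / x.1, A' / B', B' / A',
      div_pos hA' (hA'.trans_le ((hb' 0).1.trans (hb' 0).2)), ?_, ?_⟩
    · rw [Function.iterate_succ_apply']
      exact norm_mulShift_bounds hA' hb'
    · rw [Function.iterate_succ_apply']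
      exact clusterIn_mulShift hu' hA' hb'

/-- **Pigeonhole: a non-periodic rotation `c₀ ζ^k` (`|ζ| = 1`, `ζ` not a root of unity, `c₀ ≠ 0`)
does not cluster in any finite set.**  If it were eventually within `δ/2` of an `N`-element set,
two of `N + 1` consecutive terms would share a neighbour, forcing `|c₀| |1 - ζ^j| < δ` for some
`1 ≤ j ≤ N`, against the choice `δ = min_{1 ≤ j ≤ N} |c₀| |1 - ζ^j| > 0`. [folklore] -/
theorem not_clusterIn_rotation {c₀ ζ : ℂ} (hc₀ : c₀ ≠ 0) (hζ : ‖ζ‖ = 1)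
    (hroot : ∀ j : ℕ, 0 < j → ζ ^ j ≠ 1) (hv : ∀ k, v k = c₀ * ζ ^ k) (Z : Finset ℂ) :
    ¬ ClusterIn v Z := by
  classical
  intro hcl
  have hvB : ∀ k, ‖v k‖ ≤ ‖c₀‖ := fun k => by rw [hv, norm_mul, norm_pow, hζ, one_pow, mul_one]
  have hdist : ∀ k j, ‖v k - v (k + j)‖ = ‖c₀ - c₀ * ζ ^ j‖ := by
    intro k j
    have : v k - v (k + j) = ζ ^ k * (c₀ - c₀ * ζ ^ j) := by rw [hv, hv, pow_add]; ring
    rw [this, norm_mul, norm_pow, hζ, one_pow, one_mul]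
  have hpos : ∀ j, 0 < j → 0 < ‖c₀ - c₀ * ζ ^ j‖ := by
    intro j hj
    rw [norm_pos_iff, sub_ne_zero]
    intro h
    exact hroot j hj (mul_left_cancel₀ hc₀ (h.symm.trans (mul_one c₀).symm))
  set N := Z.card with hN
  obtain ⟨δ, hδ, hδle⟩ : ∃ δ : ℝ, 0 < δ ∧ ∀ j ∈ Finset.Icc 1 N, δ ≤ ‖c₀ - c₀ * ζ ^ j‖ := by
    rcases (Finset.Icc 1 N).eq_empty_or_nonempty with h | h
    · exact ⟨1, one_pos, by simp [h]⟩
    · refine ⟨(Finset.Icc 1 N).inf' h fun j => ‖c₀ - c₀ * ζ ^ j‖, ?_, fun j hj =>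
        Finset.inf'_le _ hj⟩
      rw [Finset.lt_inf'_iff]
      intro j hj
      exact hpos j (Finset.mem_Icc.mp hj).1
  have hev := hcl.eventually_exists_norm_sub_lt hvB (half_pos hδ)
  obtain ⟨K, hK⟩ := Filter.eventually_atTop.mp hev
  choose! r hrZ hrd using hK
  have hmaps : Set.MapsTo r (Finset.Icc K (K + N) : Finset ℕ) Z := fun k hk =>
    hrZ k (Finset.mem_Icc.mp (Finset.mem_coe.mp hk)).1
  have hcard : Z.card < (Finset.Icc K (K + N)).card := by
    rw [Nat.card_Icc]; omega
  obtain ⟨k, hk, k', hk', hne, heq⟩ := Finset.exists_ne_map_eq_of_card_lt_of_maps_to hcard hmaps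
  have key : ∀ k k' : ℕ, k ∈ Finset.Icc K (K + N) → k' ∈ Finset.Icc K (K + N) → k < k' →
      r k = r k' → False := by
    intro k k' hk hk' hlt heq
    rw [Finset.mem_Icc] at hk hk'
    obtain ⟨j, rfl⟩ := Nat.exists_eq_add_of_lt hlt
    have hj : j + 1 ∈ Finset.Icc 1 N := Finset.mem_Icc.mpr ⟨by omega, by omega⟩
    have h1 := hrd k hk.1
    have h2 := hrd (k + j + 1) hk'.1
    rw [← heq, Nat.add_assoc] at h2
    have h3 : ‖v k - v (k + (j + 1))‖ < δ := by
      calc ‖v k - v (k + (j + 1))‖ = ‖(v k - r k) - (v (k + (j + 1)) - r k)‖ := by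
            congr 1; ring
        _ ≤ ‖v k - r k‖ + ‖v (k + (j + 1)) - r k‖ := norm_sub_le _ _
        _ < δ / 2 + δ / 2 := add_lt_add h1 h2
        _ = δ := by ring
    rw [hdist] at h3
    exact (not_lt.mpr (hδle (j + 1) hj)) h3
  rcases Nat.lt_or_gt_of_ne hne with h | h
  · exact key k k' hk hk' h heq
  · exact key k' k hk' hk h heq.symm

end Cluster

/-! ## Part E. The elimination lemma along oscillating fibres -/

section Elimination

/-- **The leading `z`-coefficient dies along the sequence.** Let `G ∈ ℂ[w][z]` vanish at
`(w_k, z_k)` with `|z_k| → ∞` and `|w_k| ≤ B`. Then `lc_z(G)(w_k) → 0` (compare the top power of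
`z_k` with the bounded lower-order coefficients). [folklore] -/
theorem tendsto_norm_leadingCoeff_eval (G : Polynomial (Polynomial ℂ)) (z w : ℕ → ℂ)
    (hz : Tendsto (fun k => ‖z k‖) atTop atTop) {B : ℝ} (hw : ∀ k, ‖w k‖ ≤ B)
    (hG : ∀ k, G.eval₂ (Polynomial.evalRingHom (w k)) (z k) = 0) :
    Tendsto (fun k => ‖G.leadingCoeff.eval (w k)‖) atTop (𝓝 0) := by
  set M : ℝ := ∑ i ∈ Finset.range G.natDegree,
    (∑ j ∈ Finset.range ((G.coeff i).natDegree + 1), ‖(G.coeff i).coeff j‖) *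
      max 1 B ^ (G.coeff i).natDegree with hM
  have hmax : (0 : ℝ) ≤ max 1 B := zero_le_one.trans (le_max_left _ _)
  have hM0 : 0 ≤ M := Finset.sum_nonneg fun i _ =>
    mul_nonneg (Finset.sum_nonneg fun j _ => norm_nonneg _) (pow_nonneg hmax _)
  have hcoef : ∀ i k, ‖(G.coeff i).eval (w k)‖ ≤
      (∑ j ∈ Finset.range ((G.coeff i).natDegree + 1), ‖(G.coeff i).coeff j‖) *
        max 1 B ^ (G.coeff i).natDegree := fun i k =>
    (norm_eval_le_sum_mul_pow (G.coeff i) (w k)).trans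
      (mul_le_mul_of_nonneg_left (pow_le_pow_left₀ (zero_le_one.trans (le_max_left _ _))
        (max_le_max le_rfl (hw k)) _) (Finset.sum_nonneg fun j _ => norm_nonneg _))
  have hsum : ∀ k, G.leadingCoeff.eval (w k) * z k ^ G.natDegree =
      -∑ i ∈ Finset.range G.natDegree, (G.coeff i).eval (w k) * z k ^ i := by
    intro k
    have h := hG k
    rw [Polynomial.eval₂_eq_sum_range, Finset.sum_range_succ] at h
    simp only [Polynomial.coe_evalRingHom] at h
    rw [Polynomial.leadingCoeff]
    linear_combination h
  have hev : ∀ᶠ k in atTop, ‖G.leadingCoeff.eval (w k)‖ ≤ M * ‖z k‖⁻¹ := by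
    filter_upwards [hz.eventually_ge_atTop 1] with k hk
    have hzpos : 0 < ‖z k‖ := one_pos.trans_le hk
    have hbound : ‖G.leadingCoeff.eval (w k)‖ * ‖z k‖ ^ G.natDegree ≤
        M * ‖z k‖ ^ (G.natDegree - 1) := by
      rw [← norm_pow, ← norm_mul, hsum k, norm_neg, hM, Finset.sum_mul]
      refine (norm_sum_le _ _).trans (Finset.sum_le_sum fun i hi => ?_)
      rw [norm_mul, norm_pow]
      refine mul_le_mul (hcoef i k) ?_ (pow_nonneg (norm_nonneg _) _) ?_
      · exact pow_le_pow_right₀ hk (Nat.le_sub_one_of_lt (Finset.mem_range.mp hi))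
      · exact mul_nonneg (Finset.sum_nonneg fun j _ => norm_nonneg _) (pow_nonneg hmax _)
    rcases Nat.eq_zero_or_pos G.natDegree with h0 | hpos
    · have hlc : G.leadingCoeff.eval (w k) = 0 := by
        have := hsum k
        rw [h0] at this
        simpa using this
      rw [hlc, norm_zero]
      exact mul_nonneg hM0 (inv_nonneg.mpr (norm_nonneg _))
    · obtain ⟨n', hn'⟩ : ∃ n', G.natDegree = n' + 1 := ⟨G.natDegree - 1, by omega⟩
      rw [hn', pow_succ, Nat.add_sub_cancel] at hbound
      rw [le_mul_inv_iff₀ hzpos]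
      have hzn : 0 < ‖z k‖ ^ n' := pow_pos hzpos _
      by_contra hlt
      rw [not_le] at hlt
      have h2 := mul_lt_mul_of_pos_right hlt hzn
      nlinarith [hbound, h2]
  have hlim : Tendsto (fun k => M * ‖z k‖⁻¹) atTop (𝓝 0) := by
    simpa using (tendsto_inv_atTop_zero.comp hz).const_mul M
  exact squeeze_zero' (Eventually.of_forall fun k => norm_nonneg _) hev hlim

/-- **Elimination lemma along oscillating fibres.**  Let `G ∈ ℂ[w][z]` vanish at `(w_k, z_k)`,
`k ∈ ℕ`, where `|z_k| → ∞`, `0 < A ≤ |w_k| ≤ B`, and the `m`-th multiplicative difference of `w` is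
a non-periodic rotation `c₀ ζ^k` (`c₀ ≠ 0`, `|ζ| = 1`, `ζ` not a root of unity).  Then `G = 0`:
otherwise the cluster points of `w` are roots of `lc_z(G)` (`clusterIn_roots_of_tendsto`), hence the
rotation clusters in a finite set (`ClusterIn.iterate_mulShift`), contradicting
`not_clusterIn_rotation`. (new in this file) [folklore] -/
theorem eq_zero_of_eval₂_eq_zero_of_rotation (G : Polynomial (Polynomial ℂ)) (z w : ℕ → ℂ)
    (hz : Tendsto (fun k => ‖z k‖) atTop atTop) {A B : ℝ} (hA : 0 < A)
    (hw : ∀ k, A ≤ ‖w k‖ ∧ ‖w k‖ ≤ B) (m : ℕ) {c₀ ζ : ℂ} (hc₀ : c₀ ≠ 0) (hζ : ‖ζ‖ = 1)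
    (hroot : ∀ j : ℕ, 0 < j → ζ ^ j ≠ 1) (hrot : ∀ k, mulShift^[m] w k = c₀ * ζ ^ k)
    (hG : ∀ k, G.eval₂ (Polynomial.evalRingHom (w k)) (z k) = 0) : G = 0 := by
  by_contra hG0
  have hlead := tendsto_norm_leadingCoeff_eval G z w hz (fun k => (hw k).2) hG
  have hcl : ClusterIn w G.leadingCoeff.roots.toFinset :=
    clusterIn_roots_of_tendsto (Polynomial.leadingCoeff_ne_zero.mpr hG0) hlead
  obtain ⟨Z', A', B', -, -, hcl'⟩ := hcl.iterate_mulShift hA hw m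
  exact not_clusterIn_rotation hc₀ hζ hroot hrot Z' hcl'

end Elimination

/-! ## Part F. The transposed pull-back `ℂ[x₀,x₁,y₀,y₁] → ℂ[w][z]` and the density criterion -/

section Transposed

variable (p q : Polynomial ℂ)

/-- The symbolic parametrisation of `S_{p,q}` in `ℂ[w][z]` (outer variable `z = x₀`, inner `w = y₁`):
`x₀ ↦ z`, `x₁ ↦ p(z)`, `y₀ ↦ q(w)`, `y₁ ↦ w` — the transpose of `gpSymb`. [folklore] -/
def gpSymbT : Fin 2 ⊕ Fin 2 → Polynomial (Polynomial ℂ) :=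
  Sum.elim ![Polynomial.X, p.map Polynomial.C] ![Polynomial.C q, Polynomial.C Polynomial.X]

/-- Pull-back of `F ∈ ℂ[x₀, x₁, y₀, y₁]` to `ℂ[w][z]` along `gpSymbT`. [folklore] -/
def gpPullbackT (F : MvPolynomial (Fin 2 ⊕ Fin 2) ℂ) : Polynomial (Polynomial ℂ) :=
  eval₂Hom (Polynomial.C.comp Polynomial.C) (gpSymbT p q) F

/-- `mmEval w u` (inner `↦ w`, outer `↦ u`) on the symbols `gpSymbT` gives `gpParam p q u w`.
[folklore] -/
theorem mmEval_gpSymbT (u w : ℂ) : (fun i => mmEval w u (gpSymbT p q i)) = gpParam p q u w := by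
  funext i
  rcases i with i | i <;> fin_cases i <;> simp [gpSymbT, gpParam]

/-- **The transposed pull-back evaluates to `F` on the parametrised point.** [folklore] -/
theorem mmEval_gpPullbackT (F : MvPolynomial (Fin 2 ⊕ Fin 2) ℂ) (u w : ℂ) :
    mmEval w u (gpPullbackT p q F) = MvPolynomial.eval (gpParam p q u w) F := by
  rw [gpPullbackT, ← RingHom.comp_apply, MvPolynomial.comp_eval₂Hom, mmEval_comp_C, mmEval_gpSymbT]
  rfl

/-- **Density criterion, oscillatory regime.** If `S_{p,q} = {x₁ = p(x₀), y₀ = q(y₁)}` carries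
exponential points `(z_k, p(z_k), q(w_k), w_k)`, `k ∈ ℕ`, with `|z_k| → ∞`, `w_k` in an annulus
`0 < A ≤ |w_k| ≤ B`, and some multiplicative difference of `w` a non-periodic rotation, then
`I(S_{p,q} ∩ Γ_exp) = I(S_{p,q})`. (new in this file) [folklore] -/
theorem unprojectedDense_graphPolySurface_of_rotation (z w : ℕ → ℂ)
    (hz : Tendsto (fun k => ‖z k‖) atTop atTop) {A B : ℝ} (hA : 0 < A)
    (hw : ∀ k, A ≤ ‖w k‖ ∧ ‖w k‖ ≤ B) (m : ℕ) {c₀ ζ : ℂ} (hc₀ : c₀ ≠ 0) (hζ : ‖ζ‖ = 1)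
    (hroot : ∀ j : ℕ, 0 < j → ζ ^ j ≠ 1) (hrot : ∀ k, mulShift^[m] w k = c₀ * ζ ^ k)
    (hexp₁ : ∀ k, exp (z k) = q.eval (w k)) (hexp₂ : ∀ k, exp (p.eval (z k)) = w k) :
    UnprojectedDense (graphPolySurface p q) := by
  refine le_antisymm ?_ (vanishingIdeal_anti_mono Set.inter_subset_left)
  intro F hF
  have hG0 : gpPullbackT p q F = 0 := by
    refine eq_zero_of_eval₂_eq_zero_of_rotation (gpPullbackT p q F) z w hz hA hw m hc₀ hζ hroot
      hrot fun k => ?_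
    rw [← mmEval_eq_eval₂, mmEval_gpPullbackT]
    exact eval_eq_zero_of_mem_vanishingIdeal hF
      ⟨gpParam_mem p q _ _, gpParam_mem_expGraph p q (hexp₁ k) (hexp₂ k)⟩
  refine mem_vanishingIdeal_of_eval fun s hs => ?_
  have h := mmEval_gpPullbackT p q F (s (Sum.inl 0)) (s (Sum.inr 1))
  rw [hG0, map_zero, ← eq_gpParam_of_mem p q hs] at h
  exact h.symm

end Transposed

/-! ## Part G. Constant fibres in the oscillatory regime: differencing -/

section Differencing

/-- Iterated forward differences of the restriction of `f : ℂ → ℂ` to `ℕ` are the restrictions of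
the iterated forward differences. [folklore] -/
theorem fwdDiff_iter_natCast (f : ℂ → ℂ) (j : ℕ) :
    ((fwdDiff (1 : ℕ))^[j] fun n : ℕ => f n) = fun k : ℕ => ((fwdDiff (1 : ℂ))^[j] f) (k : ℂ) := by
  induction j generalizing f with
  | zero => rfl
  | succ j ih =>
    rw [Function.iterate_succ_apply, Function.iterate_succ_apply]
    have : (Δ_[1] fun n : ℕ => f n) = fun n : ℕ => (Δ_[1] f) (n : ℂ) := by
      funext n
      simp [fwdDiff, Nat.cast_succ]
    rw [this, ih]

/-- **Multiplicative differences of `e^{g}` are exponentials of forward differences**: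
`mulShift^[j] (e^{g}) = e^{Δ^j g}`. [folklore] -/
theorem iterate_mulShift_exp (g : ℕ → ℂ) (j : ℕ) :
    mulShift^[j] (fun k => exp (g k)) = fun k => exp (((fwdDiff (1 : ℕ))^[j] g) k) := by
  induction j generalizing g with
  | zero => rfl
  | succ j ih =>
    rw [Function.iterate_succ_apply, Function.iterate_succ_apply]
    have : mulShift (fun k => exp (g k)) = fun k => exp ((Δ_[1] g) k) := by
      funext k
      simp [mulShift, fwdDiff, Complex.exp_sub]
    rw [this, ih]

/-- A function with constant forward difference `c` is affine on `ℕ`: `F(k) = F(0) + k c`.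
[folklore] -/
theorem eq_add_mul_of_fwdDiff_eq_const {F : ℂ → ℂ} {c : ℂ} (hF : ∀ x, Δ_[1] F x = c) (k : ℕ) :
    F k = F 0 + k * c := by
  induction k with
  | zero => simp
  | succ k ih =>
    have h := hF k
    simp only [fwdDiff] at h
    push_cast
    linear_combination h + ih

/-- **Density for constant fibres in the oscillatory regime with irrational top phase.**
Let `S = {x₁ = p(x₀), y₀ = c}`, `c = e^{z₀}`, `deg p ≥ 1`.  Suppose `Re p` is constant on
`z₀ + 2πiℕ` (so the fibre values `w_k = e^{p(z₀ + 2πik)}` of the exponential points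
`(z₀ + 2πik, p(z₀ + 2πik), c, w_k)` stay on a circle) and the top phase `θ ∈ ℝ`,
`θ · 2πi = (deg p)! · lc(p) · (2πi)^{deg p}`, is irrational.  Then the exponential points of `S` are
Zariski dense.  Proof: the `(deg p - 1)`-st multiplicative difference of `w_k` is `c₀ ζ^k` with
`ζ = e^{2πiθ}` (`Polynomial.fwdDiff_iter_degree_eq_factorial`), and
`unprojectedDense_graphPolySurface_of_rotation` applies. (new in this file) [folklore] -/
theorem unprojectedDense_const_of_irrational {p : Polynomial ℂ} (hd : 0 < p.natDegree) (z₀ : ℂ)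
    (hR : ∀ k : ℕ, (p.eval (z₀ + k * (2 * Real.pi * I))).re = (p.eval z₀).re) {θ : ℝ}
    (hθ : (θ : ℂ) * (2 * Real.pi * I) =
      (p.natDegree.factorial : ℂ) * p.leadingCoeff * (2 * Real.pi * I) ^ p.natDegree)
    (hirr : Irrational θ) {c : ℂ} (hc : exp z₀ = c) :
    UnprojectedDense (graphPolySurface p (Polynomial.C c)) := by
  -- the exponential points
  set z : ℕ → ℂ := fun k => z₀ + k * (2 * Real.pi * I) with hz_def
  set w : ℕ → ℂ := fun k => exp (p.eval (z k)) with hw_def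
  have hexp₁ : ∀ k, exp (z k) = (Polynomial.C c).eval (w k) := fun k => by
    rw [Polynomial.eval_C]
    show exp (z₀ + k * (2 * Real.pi * I)) = c
    rw [Complex.exp_add, hc, Complex.exp_nat_mul_two_pi_mul_I, mul_one]
  have hexp₂ : ∀ k, exp (p.eval (z k)) = w k := fun k => rfl
  -- `|z_k| → ∞`
  have hzlim : Tendsto (fun k => ‖z k‖) atTop atTop := by
    refine tendsto_norm_atTop_of_le (K := fun k : ℕ => (k : ℝ)) tendsto_natCast_atTop_atTop
      Real.two_pi_pos (b := ‖z₀‖) fun k => ?_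
    have h1 : ‖(k : ℂ) * (2 * Real.pi * I)‖ = 2 * Real.pi * k := by
      rw [norm_mul, Complex.norm_natCast, norm_mul, norm_mul, Complex.norm_I, Complex.norm_real,
        Real.norm_eq_abs, abs_of_pos Real.pi_pos, Complex.norm_two]
      ring
    have h2 := norm_sub_le (z₀ + k * (2 * Real.pi * I)) z₀
    rw [add_sub_cancel_left, h1] at h2
    show 2 * Real.pi * k - ‖z₀‖ ≤ ‖z₀ + k * (2 * Real.pi * I)‖
    linarith
  -- `|w_k| = R` constant
  have hRpos : 0 < Real.exp (p.eval z₀).re := Real.exp_pos _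
  have hwR : ∀ k, Real.exp (p.eval z₀).re ≤ ‖w k‖ ∧ ‖w k‖ ≤ Real.exp (p.eval z₀).re := fun k => by
    have : ‖w k‖ = Real.exp (p.eval z₀).re := by
      show ‖exp (p.eval (z₀ + k * (2 * Real.pi * I)))‖ = _
      rw [Complex.norm_exp, hR k]
    exact ⟨this.ge, this.le⟩
  -- the polynomial `P(t) = p(z₀ + 2πi t)`
  obtain ⟨P, hP⟩ : ∃ P : Polynomial ℂ,
      P = p.comp (Polynomial.C (2 * Real.pi * I) * Polynomial.X + Polynomial.C z₀) := ⟨_, rfl⟩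
  have hPeval : ∀ k : ℕ, P.eval (k : ℂ) = p.eval (z k) := fun k => by
    simp only [hP, hz_def, Polynomial.eval_comp, Polynomial.eval_add, Polynomial.eval_mul,
      Polynomial.eval_C, Polynomial.eval_X]
    ring_nf
  have hlin : (Polynomial.C (2 * Real.pi * I) * Polynomial.X + Polynomial.C z₀).natDegree = 1 :=
    Polynomial.natDegree_linear Complex.two_pi_I_ne_zero
  have hPdeg : P.natDegree = p.natDegree := by
    rw [hP, Polynomial.natDegree_comp, hlin, mul_one]
  have hPlc : P.leadingCoeff = p.leadingCoeff * (2 * Real.pi * I) ^ p.natDegree := by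
    rw [hP, Polynomial.leadingCoeff_comp (by rw [hlin]; exact one_ne_zero),
      Polynomial.leadingCoeff_linear Complex.two_pi_I_ne_zero]
  -- `F = Δ^{d-1} P` has constant difference `θ · 2πi`
  obtain ⟨F, hF⟩ : ∃ F : ℂ → ℂ, F = (fwdDiff (1 : ℂ))^[p.natDegree - 1] (fun x => P.eval x) :=
    ⟨_, rfl⟩
  have hΔF : ∀ x, Δ_[1] F x = (θ : ℂ) * (2 * Real.pi * I) := fun x => by
    have e : (p.natDegree - 1).succ = p.natDegree := Nat.succ_pred_eq_of_pos hd
    have h1 : Δ_[1] F = (fwdDiff (1 : ℂ))^[p.natDegree] (fun x => P.eval x) := by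
      rw [hF, ← Function.iterate_succ_apply' (f := fwdDiff (1 : ℂ)), e]
    have h2 := congrFun (Polynomial.fwdDiff_iter_degree_eq_factorial P) x
    rw [hPdeg] at h2
    rw [h1, h2, Pi.smul_apply, smul_eq_mul, Pi.natCast_apply, hPlc, hθ]
    ring
  -- the `(d-1)`-st multiplicative difference of `w` is the rotation `e^{F(0)} ζ^k`
  have hrot : ∀ k, mulShift^[p.natDegree - 1] w k =
      exp (F 0) * exp ((θ : ℂ) * (2 * Real.pi * I)) ^ k := by
    intro k
    have hwg : w = fun k => exp ((fun n : ℕ => P.eval (n : ℂ)) k) := by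
      funext k
      simp only [hw_def, hPeval]
    have key : ((fwdDiff (1 : ℕ))^[p.natDegree - 1] fun n : ℕ => P.eval (n : ℂ)) k = F (k : ℂ) := by
      rw [hF]
      exact congrFun (fwdDiff_iter_natCast (fun x => P.eval x) (p.natDegree - 1)) k
    rw [hwg, iterate_mulShift_exp]
    dsimp only
    rw [key, eq_add_mul_of_fwdDiff_eq_const hΔF k, Complex.exp_add, Complex.exp_nat_mul]
  -- `ζ = e^{2πiθ}`: modulus one, not a root of unity since `θ ∉ ℚ`
  have hζ : ‖exp ((θ : ℂ) * (2 * Real.pi * I))‖ = 1 := by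
    have : (θ : ℂ) * (2 * Real.pi * I) = ((θ * (2 * Real.pi) : ℝ) : ℂ) * I := by push_cast; ring
    rw [this, Complex.norm_exp_ofReal_mul_I]
  have hroot : ∀ j : ℕ, 0 < j → exp ((θ : ℂ) * (2 * Real.pi * I)) ^ j ≠ 1 := by
    intro j hj h
    rw [← Complex.exp_nat_mul, Complex.exp_eq_one_iff] at h
    obtain ⟨n, hn⟩ := h
    have h2 : ((j : ℂ) * θ) * (2 * Real.pi * I) = (n : ℂ) * (2 * Real.pi * I) := by
      rw [← hn]; ring
    have h3 := mul_right_cancel₀ Complex.two_pi_I_ne_zero h2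
    have h4 : ((j : ℝ) * θ : ℝ) = (n : ℝ) := by exact_mod_cast h3
    exact (hirr.natCast_mul (Nat.pos_iff_ne_zero.mp hj)).ne_int n h4
  exact unprojectedDense_graphPolySurface_of_rotation p (Polynomial.C c) z w hzlim hRpos hwR
    (p.natDegree - 1) (Complex.exp_ne_zero _) hζ hroot hrot hexp₁ hexp₂

/-- The case certificate for constant fibres: `{x₁ = p(x₀), y₀ = c}` with `deg p ≥ 2`, `c ≠ 0` is in
case (dim-pi-S-1-free) (`mmCase_graphPolySurface_of_two_le`). [folklore] -/
theorem mmCase_graphPolySurface_C {p : Polynomial ℂ} (hd : 2 ≤ p.natDegree) {c : ℂ} (hc : c ≠ 0) :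
    MMCaseDimPiOneFree (graphPolySurface p (Polynomial.C c)) :=
  mmCase_graphPolySurface_of_two_le hd (Polynomial.C_ne_zero.mpr hc)

end Differencing

/-! ## Part H. The cubic `{x₁ = x₀³, y₀ = 1}`: dense, by Lindemann -/

section Cubic

/-- **The constant-fibre cubic** `S_cub = {x₁ = x₀³, y₀ = 1} ⊆ ℂ² × ℂ²`; its exponential points are
`(2πik, (2πik)³, 1, e^{-8π³ik³})`, `k ∈ ℤ` (`exists_int_of_mem_const_inter_expGraph`), all with
`|y₁| = 1`. (new in this file) [folklore] -/
def cubicConstOne : Set (Fin 2 ⊕ Fin 2 → ℂ) :=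
  graphPolySurface (Polynomial.X ^ 3) (Polynomial.C 1)

/-- `Re (2πik)³ = 0 = Re 0³`: the cubic is in the oscillatory regime along `2πiℕ`. [folklore] -/
theorem re_eval_X_pow_three (k : ℕ) :
    ((Polynomial.X ^ 3 : Polynomial ℂ).eval ((0 : ℂ) + k * (2 * Real.pi * I))).re =
      ((Polynomial.X ^ 3 : Polynomial ℂ).eval 0).re := by
  simp only [Polynomial.eval_pow, Polynomial.eval_X, zero_add]
  have hI3 : I ^ 3 = -I := by rw [pow_succ, Complex.I_sq]; ring
  have : ((k : ℂ) * (2 * Real.pi * I)) ^ 3 =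
      -((((k : ℝ) ^ 3 * (2 * Real.pi) ^ 3 : ℝ)) : ℂ) * I := by
    rw [mul_pow, mul_pow, hI3]; push_cast; ring
  rw [this, zero_pow three_ne_zero, Complex.zero_re, neg_mul, Complex.neg_re, Complex.re_ofReal_mul,
    Complex.I_re, mul_zero, neg_zero]

/-- The top phase of the cubic: `θ · 2πi = 3! · 1 · (2πi)³`, i.e. `θ = -24π²`. [folklore] -/
theorem cubic_theta : ((-24 * Real.pi ^ 2 : ℝ) : ℂ) * (2 * Real.pi * I) =
    ((Polynomial.X ^ 3 : Polynomial ℂ).natDegree.factorial : ℂ) *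
      (Polynomial.X ^ 3 : Polynomial ℂ).leadingCoeff *
        (2 * Real.pi * I) ^ (Polynomial.X ^ 3 : Polynomial ℂ).natDegree := by
  have hI3 : I ^ 3 = -I := by rw [pow_succ, Complex.I_sq]; ring
  rw [Polynomial.natDegree_X_pow, Polynomial.leadingCoeff_X_pow,
    show Nat.factorial 3 = 6 by rfl, mul_pow, mul_pow, hI3]
  push_cast
  ring

/-- **`-24π²` is irrational** — Lindemann's theorem (`transcendental_pi_holds`, proved in the tree).
[cite: Lindemann1882] -/
theorem irrational_cubic_theta : Irrational (-24 * Real.pi ^ 2) := by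
  have h : Irrational (Real.pi ^ 2) := (transcendental_pi_holds.pow two_pos).irrational
  have : (-24 * Real.pi ^ 2 : ℝ) = ((-24 : ℤ) : ℝ) * Real.pi ^ 2 := by push_cast; ring
  rw [this]
  exact h.intCast_mul (by norm_num)

/-- **The exponential points of `{x₁ = x₀³, y₀ = 1}` are Zariski dense** (oscillatory constant
fibre, irrational top phase `-24π²`). (new in this file) [folklore] -/
theorem unprojectedDense_cubicConstOne : UnprojectedDense cubicConstOne :=
  unprojectedDense_const_of_irrational (p := Polynomial.X ^ 3)
    (by rw [Polynomial.natDegree_X_pow]; norm_num) 0 re_eval_X_pow_three cubic_theta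
    irrational_cubic_theta Complex.exp_zero

/-- `S_cub` is in case (dim-pi-S-1-free). [cite: MantovaMasser2023, Thm. 1.2 case (dim-pi-S-1-free), p. 4] -/
theorem mmCase_cubicConstOne : MMCaseDimPiOneFree cubicConstOne :=
  mmCase_graphPolySurface_C (by rw [Polynomial.natDegree_X_pow]; norm_num) one_ne_zero

/-- `S_cub` is NOT multiplicatively free — exactly as degenerate as the resonant parabola, yet dense:
inside the non-free constant-fibre family the answer is arithmetic, not geometric. [folklore] -/
theorem not_isMulFree_cubicConstOne : ¬ IsMulFree ℂ 2 (cubicConstOne ∩ torusLocus ℂ 2) :=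
  not_isMulFree_graphPolySurface_C _ _

/-- **Irrationality of `π²` is exactly what is at stake for `S_cub`.**  If `π² = a/b` were
rational, the fibre values `e^{(2πik)³} = e^{2πi · (-4 a k³)/b}` would be `|b|`-th roots of unity —
finitely many — and the exponential points of `S_cub` would NOT be Zariski dense
(`not_unprojectedDense_const_of_finite`).  (A counterfactual: the hypothesis contradicts
`irrational_cubic_theta`; the point is that no geometric argument can decide density inside the
non-free constant-fibre family.) (new in this file) [folklore] -/
theorem not_unprojectedDense_cubicConstOne_of_rat {a b : ℤ} (hb : b ≠ 0)
    (hab : Real.pi ^ 2 = a / b) : ¬ UnprojectedDense cubicConstOne := by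
  classical
  refine not_unprojectedDense_const_of_finite (Polynomial.X ^ 3) (z₀ := 0) Complex.exp_zero
    ((Finset.range b.natAbs).image fun j : ℕ => exp ((j : ℂ) / b * (2 * Real.pi * I)))
    fun k => ?_
  have hb' : (b : ℂ) ≠ 0 := by exact_mod_cast hb
  have hπ : (Real.pi : ℂ) ^ 2 = (a : ℂ) / b := by
    have h := congrArg (fun r : ℝ => (r : ℂ)) hab
    push_cast at h
    exact h
  have ha : (a : ℂ) = (Real.pi : ℂ) ^ 2 * b := by rw [hπ, div_mul_cancel₀ _ hb']
  obtain ⟨N, hN⟩ : ∃ N : ℤ, N = -4 * a * k ^ 3 := ⟨_, rfl⟩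
  have h1 : (Polynomial.X ^ 3 : Polynomial ℂ).eval ((0 : ℂ) + k * (2 * Real.pi * I)) =
      (N : ℂ) / b * (2 * Real.pi * I) := by
    have hI3 : I ^ 3 = -I := by rw [pow_succ, Complex.I_sq]; ring
    simp only [Polynomial.eval_pow, Polynomial.eval_X, zero_add]
    rw [mul_pow, mul_pow, hI3, hN]
    push_cast
    rw [ha]
    field_simp
    ring
  have hdiv : (N : ℂ) / b * (2 * Real.pi * I) =
      ((N % b : ℤ) : ℂ) / b * (2 * Real.pi * I) + ((N / b : ℤ) : ℂ) * (2 * Real.pi * I) := by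
    have e : ((N % b : ℤ) : ℂ) + (b : ℂ) * ((N / b : ℤ) : ℂ) = (N : ℂ) := by
      exact_mod_cast Int.emod_add_mul_ediv N b
    rw [← e, add_div, mul_div_cancel_left₀ _ hb']
    ring
  rw [h1, hdiv, Complex.exp_add, Complex.exp_int_mul_two_pi_mul_I, mul_one]
  have h0 : 0 ≤ N % b := Int.emod_nonneg N hb
  have hlt : N % b < |b| := Int.emod_lt_abs N hb
  refine Finset.mem_image.mpr ⟨(N % b).toNat, Finset.mem_range.mpr ?_, ?_⟩
  · rw [Int.abs_eq_natAbs] at hlt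
    omega
  · have hc : (((N % b).toNat : ℕ) : ℂ) = ((N % b : ℤ) : ℂ) := by
      rw [← Int.cast_natCast, Int.toNat_of_nonneg h0]
    rw [hc]

/-- **An affirmative instance of Mantova–Masser's question in the oscillatory regime**:
`{x₁ = x₀³, y₀ = 1}` is in case (dim-pi-S-1-free) and its exponential points are Zariski dense.
(new in this file) [cite: MantovaMasser2023, §1 Further remarks, p. 5] -/
theorem unprojectedDensityQuestion_instance_cubicConstOne :
    MMCaseDimPiOneFree cubicConstOne ∧ UnprojectedDense cubicConstOne :=
  ⟨mmCase_cubicConstOne, unprojectedDense_cubicConstOne⟩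

end Cubic

end Literature.ModelTheory.Zilber
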